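import Mathlib
import Summits.Ventures.CertifiedArithmetic.LowPrec.OptCeilMinimax

/-!
# Opt / R4 — Theorem S6 (SSE): the exact gain of any power-of-two scale search over the non-clipping scale, with attainment; Theorem S5 (SSE half) — generic part

HONEST FRAMING: certified error envelopes and provably optimal rounding/accumulation schemes for
low-precision formats under stated cost models; every table by two implementations; no hardware or
vendor claims.

OPTIMA.md Theorem S6: `0 ≤ SSE(e_nc) - min_e SSE(e) ≤ (k-1) (δ_{e_nc}/2)²`. In the units of this file the
non-clipping grid `(2u) • B` has finest spacing `2u`, so the bound reads `SSE(2u; x) ≤ SSE(v; x) + (k-1) u²`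
for every power-of-two scale `v`. Proof: elements `≥ L u` (in particular the block maximum) never gain
(zone equality / clipping, chained through all finer scales: `err_coarse_le_finer`); elements `< L u`
have coarse error `≤ u`, so each gains at most `u²`; coarser scales never gain (Theorem S3(i)).

Contents (generic over a grid `B` with top `T = 2 Tm`, coincidence-zone bottom `L = 2 Lm`, low-zone
coarse covering radius `u`, fine covering radius `R u`): `blockSSE`; `err_coarse_le_of_ge` /
`err_coarse_le_finer` (no gain at or above `L u`, through every finer scale); `sq_gain_le`; THEOREM S6
bound `sse_gain_le` (`SSE(2u) ≤ SSE(u/2^j) + (k-1) u²`) and `sse_coarser_le`; THEOREM S6 attainment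
`sse_gain_attained` (block `(T u + u, u, …, u)` gains exactly `(k-1) u²` at the half scale); THEOREM S5
SSE half `ceil_vs_half_sse` (adversarial block for the half scale) and `finer_sse_const` (finer scales).
Instances for E2M1 / E2M3 / E3M2: `OptSSEInstances.lean`. Proofs: OPTIMA.md Theorems S5, S6 (opt seat,
pub-lowprec); certificate C5 in certs/opt/mxscale_{A,B}.json.
-/

namespace Summit.Ventures.CertifiedArithmetic.LowPrec.Opt

section SSEGain

variable {K : Type*} [Field K] [LinearOrder K] [IsStrictOrderedRing K]
variable {B : Finset ℕ} (hB : B.Nonempty)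

/-- block SSE at scale parameter `s` -/
def blockSSE {k : ℕ} (s : K) (x : Fin k → K) : K := ∑ i, err hB s (x i) ^ 2

/-- zone-or-above: for `y ≥ L u` the coarse error never exceeds the fine error -/
theorem err_coarse_le_of_ge {T Tm L Lm : ℕ} (hT : T ∈ B) (hle : ∀ n ∈ B, n ≤ T) (hTm : Tm ∈ B)
    (hT2 : 2 * Tm = T) (hL : L ∈ B) (hLm : Lm ∈ B) (hL2 : 2 * Lm = L)
    (hAB : ∀ n ∈ B, L ≤ 2 * n → 2 * n ≤ T → 2 * n ∈ B)
    (hBA : ∀ n ∈ B, L ≤ n → n ≤ T → ∃ m ∈ B, 2 * m = n)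
    {u y : K} (hu : 0 < u) (hLy : (L : K) * u ≤ y) : err hB (2 * u) y ≤ err hB u y := by
  by_cases h1 : (T : K) * u ≤ y
  · have := err_coarse_le_sub hB hTm hT2 (u := u) h1
    have h2 := sub_top_le_err hB hle hu.le y
    linarith
  · rw [err_coarse_eq_of_zone hB hT hTm hT2 hL hLm hL2 hAB hBA hu hLy (le_of_lt (lt_of_not_ge h1))]

/-- … chained through every finer power-of-two scale `u / 2^j` -/
theorem err_coarse_le_finer {T Tm L Lm : ℕ} (hT : T ∈ B) (hle : ∀ n ∈ B, n ≤ T) (hTm : Tm ∈ B)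
    (hT2 : 2 * Tm = T) (hL : L ∈ B) (hLm : Lm ∈ B) (hL2 : 2 * Lm = L)
    (hAB : ∀ n ∈ B, L ≤ 2 * n → 2 * n ≤ T → 2 * n ∈ B)
    (hBA : ∀ n ∈ B, L ≤ n → n ≤ T → ∃ m ∈ B, 2 * m = n)
    (j : ℕ) : ∀ {u y : K}, 0 < u → (L : K) * u ≤ y → err hB (2 * u) y ≤ err hB (u / 2 ^ j) y := by
  induction j with
  | zero =>
    intro u y hu hLy
    simpa using err_coarse_le_of_ge hB hT hle hTm hT2 hL hLm hL2 hAB hBA hu hLy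
  | succ j ih =>
    intro u y hu hLy
    have hu2 : 0 < u / 2 := by positivity
    have hL0 : (0 : K) ≤ L := Nat.cast_nonneg L
    have hLy2 : (L : K) * (u / 2) ≤ y := by nlinarith
    have step := ih hu2 hLy2
    have e1 : 2 * (u / 2) = u := by ring
    have e2 : u / 2 / 2 ^ j = u / 2 ^ (j + 1) := by rw [pow_succ]; ring
    rw [e1, e2] at step
    exact (err_coarse_le_of_ge hB hT hle hTm hT2 hL hLm hL2 hAB hBA hu hLy).trans step

/-- squared gain of a finer scale on one element: `≤ 0` above `L u`, `≤ u²` below -/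
theorem sq_gain_le {T Tm L Lm : ℕ} (hT : T ∈ B) (hle : ∀ n ∈ B, n ≤ T) (hTm : Tm ∈ B)
    (hT2 : 2 * Tm = T) (hL : L ∈ B) (hLm : Lm ∈ B) (hL2 : 2 * Lm = L)
    (hAB : ∀ n ∈ B, L ≤ 2 * n → 2 * n ≤ T → 2 * n ∈ B)
    (hBA : ∀ n ∈ B, L ≤ n → n ≤ T → ∃ m ∈ B, 2 * m = n)
    (hlow : ∀ u y : K, 0 < u → 0 ≤ y → y ≤ (L : K) * u → err hB (2 * u) y ≤ u)
    {u y : K} (hu : 0 < u) (hy0 : 0 ≤ y) (j : ℕ) :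
    err hB (2 * u) y ^ 2 - err hB (u / 2 ^ j) y ^ 2 ≤ u ^ 2 ∧
    ((L : K) * u ≤ y → err hB (2 * u) y ^ 2 - err hB (u / 2 ^ j) y ^ 2 ≤ 0) := by
  have h0c : 0 ≤ err hB (2 * u) y := gridDist_nonneg _ _
  have h0f : 0 ≤ err hB (u / 2 ^ j) y := gridDist_nonneg _ _
  have habove : (L : K) * u ≤ y → err hB (2 * u) y ^ 2 - err hB (u / 2 ^ j) y ^ 2 ≤ 0 := by
    intro hLy
    have h := err_coarse_le_finer hB hT hle hTm hT2 hL hLm hL2 hAB hBA j hu hLy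
    nlinarith
  refine ⟨?_, habove⟩
  by_cases hLy : (L : K) * u ≤ y
  · have := habove hLy
    nlinarith
  · have h1 := hlow u y hu hy0 (le_of_lt (lt_of_not_ge hLy))
    nlinarith

/-- **Theorem S6 (generic, finer scales):** `SSE(2u; x) ≤ SSE(u/2^j; x) + (k-1) u²` whenever the block
maximum is `≥ L u` (in particular for the non-clipping scale, where it is `> T u ≥ L u`). -/
theorem sse_gain_le {T Tm L Lm : ℕ} (hT : T ∈ B) (hle : ∀ n ∈ B, n ≤ T) (hTm : Tm ∈ B)
    (hT2 : 2 * Tm = T) (hL : L ∈ B) (hLm : Lm ∈ B) (hL2 : 2 * Lm = L)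
    (hAB : ∀ n ∈ B, L ≤ 2 * n → 2 * n ≤ T → 2 * n ∈ B)
    (hBA : ∀ n ∈ B, L ≤ n → n ≤ T → ∃ m ∈ B, 2 * m = n)
    (hlow : ∀ u y : K, 0 < u → 0 ≤ y → y ≤ (L : K) * u → err hB (2 * u) y ≤ u)
    {k : ℕ} (x : Fin k → K) {u : K} (hu : 0 < u) (hx0 : ∀ i, 0 ≤ x i) (i₀ : Fin k)
    (hi₀ : (L : K) * u ≤ x i₀) (j : ℕ) :
    blockSSE hB (2 * u) x ≤ blockSSE hB (u / 2 ^ j) x + ((k : K) - 1) * u ^ 2 := by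
  unfold blockSSE
  have hk : 1 ≤ k := Fin.pos i₀
  have key : ∑ i, (err hB (2 * u) (x i) ^ 2 - err hB (u / 2 ^ j) (x i) ^ 2) ≤ ((k : K) - 1) * u ^ 2 := by
    rw [← Finset.add_sum_erase _ _ (Finset.mem_univ i₀)]
    have h0 := (sq_gain_le hB hT hle hTm hT2 hL hLm hL2 hAB hBA hlow hu (hx0 i₀) j).2 hi₀
    have hrest : ∑ i ∈ Finset.univ.erase i₀,
        (err hB (2 * u) (x i) ^ 2 - err hB (u / 2 ^ j) (x i) ^ 2) ≤
        ∑ i ∈ Finset.univ.erase i₀, u ^ 2 :=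
      Finset.sum_le_sum (fun i _ => (sq_gain_le hB hT hle hTm hT2 hL hLm hL2 hAB hBA hlow hu (hx0 i) j).1)
    have hc : ∑ i ∈ Finset.univ.erase i₀, u ^ 2 = ((k : K) - 1) * u ^ 2 := by
      rw [Finset.sum_const, Finset.card_erase_of_mem (Finset.mem_univ _), Finset.card_univ,
        Fintype.card_fin, nsmul_eq_mul]
      push_cast [Nat.cast_sub hk]
      ring
    linarith
  have := Finset.sum_sub_distrib (s := Finset.univ) (f := fun i => err hB (2 * u) (x i) ^ 2)
    (g := fun i => err hB (u / 2 ^ j) (x i) ^ 2)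
  linarith

/-- coarser scales never gain in SSE (termwise, Theorem S3(i)) -/
theorem sse_coarser_le {T : ℕ} (hT : T ∈ B) (hdouble : ∀ n ∈ B, 2 * n ≤ T → 2 * n ∈ B)
    {k : ℕ} (x : Fin k → K) {s : K} (hs : 0 < s)
    (hxT : ∀ i, x i ≤ (T : K) * s) (n : ℕ) : blockSSE hB s x ≤ blockSSE hB (2 ^ n * s) x := by
  unfold blockSSE
  refine Finset.sum_le_sum (fun i _ => ?_)
  have h := coarser_le hB hT hdouble hs (hxT i) n
  have h0 : 0 ≤ err hB s (x i) := gridDist_nonneg _ _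
  nlinarith

/-- lower bound at a point `w u` far (integer distance `≥ 1` in fine units) from every COARSE grid point -/
theorem le_err_coarse_of_far {w : ℕ} (hw : ∀ n ∈ B, w + 1 ≤ 2 * n ∨ 2 * n + 1 ≤ w) {u : K} (hu : 0 < u) :
    u ≤ err hB (2 * u) ((w : K) * u) := by
  unfold err gridDist
  apply Finset.le_inf'
  intro v hv
  obtain ⟨n, hn, rfl⟩ := Finset.mem_image.mp hv
  rcases hw n hn with h | h
  · have : (w : K) + 1 ≤ 2 * n := by exact_mod_cast h
    rw [abs_of_nonpos (by nlinarith)]; nlinarith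
  · have : 2 * (n : K) + 1 ≤ w := by exact_mod_cast h
    rw [abs_of_nonneg (by nlinarith)]; nlinarith

/-- the extremal block of Theorem S6: element `0` equals `A`, all others equal `C` -/
def attBlock (k : ℕ) (A C : K) : Fin k → K := fun i => if (i : ℕ) = 0 then A else C

omit [Field K] [LinearOrder K] [IsStrictOrderedRing K] in
/-- value of `attBlock` at index `0` -/
theorem attBlock_of_eq {k : ℕ} {A C : K} {i : Fin k} (hi : (i : ℕ) = 0) : attBlock k A C i = A := by
  simp [attBlock, hi]

omit [Field K] [LinearOrder K] [IsStrictOrderedRing K] in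
/-- value of `attBlock` at a nonzero index -/
theorem attBlock_of_ne {k : ℕ} {A C : K} {i : Fin k} (hi : (i : ℕ) ≠ 0) : attBlock k A C i = C := by
  simp [attBlock, hi]

/-- **Theorem S6, attainment (generic).** The block `(T u + u, u, …, u)` (maximum just above the fine clip
point, the other `k-1` elements at the first coarse midpoint `u`) gains exactly `(k-1) u²` at the half
scale: every element has coarse error `u`; at the fine scale the maximum still has error `u` and the
others are grid points. Integer side conditions decided per format. -/
theorem sse_gain_attained {T Tm : ℕ} (hTm : Tm ∈ B) (hT2 : 2 * Tm = T) (hT : T ∈ B) (h0 : 0 ∈ B)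
    (h1 : 1 ∈ B) (hfarC : ∀ n ∈ B, T + 1 + 1 ≤ 2 * n ∨ 2 * n + 1 ≤ T + 1)
    (hfarF : ∀ n ∈ B, T + 1 + 1 ≤ n ∨ n + 1 ≤ T + 1) (hfar1 : ∀ n ∈ B, 1 + 1 ≤ 2 * n ∨ 2 * n + 1 ≤ 1)
    {k : ℕ} (hk : 1 ≤ k) {u : K} (hu : 0 < u) :
    ∃ (x : Fin k → K) (i₀ : Fin k), (∀ i, 0 ≤ x i) ∧ (∀ i, x i ≤ x i₀) ∧
      (T : K) * u < x i₀ ∧ x i₀ ≤ (T : K) * (2 * u) ∧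
      blockSSE hB (2 * u) x = blockSSE hB u x + ((k : K) - 1) * u ^ 2 := by
  have hT1 : (1 : K) ≤ T := by
    rcases hfarF 1 h1 with h | h
    · omega
    · exact_mod_cast (by omega : 1 ≤ T)
  -- the two values of the block
  set A : K := ((T + 1 : ℕ) : K) * u with hAdef
  set C : K := ((1 : ℕ) : K) * u with hCdef
  -- exact element errors
  have eC_top : err hB (2 * u) A = u := by
    apply le_antisymm
    · have hc : ((2 * Tm : ℕ) : K) = T := by rw [hT2]
      push_cast at hc
      refine err_le_of_near_abs hB (n := Tm) hTm ?_ ?_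
      · rw [hAdef]; push_cast; nlinarith
      · rw [hAdef]; push_cast; nlinarith
    · rw [hAdef]; exact le_err_coarse_of_far hB hfarC hu
  have eF_top : err hB u A = u := by
    apply le_antisymm
    · refine err_le_of_near_abs hB (n := T) hT ?_ ?_
      · rw [hAdef]; push_cast; nlinarith
      · rw [hAdef]; push_cast; nlinarith
    · rw [hAdef]; exact le_err_of_far hB hfarF hu
  have eC_one : err hB (2 * u) C = u := by
    apply le_antisymm
    · refine err_le_of_near_abs hB (n := 0) h0 ?_ ?_
      · rw [hCdef]; push_cast; nlinarith
      · rw [hCdef]; push_cast; nlinarith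
    · rw [hCdef]; exact le_err_coarse_of_far hB hfar1 hu
  have eF_one : err hB u C = 0 := by
    apply le_antisymm
    · exact err_le_of_near_abs hB (s := u) (y := C) (r := 0) (n := 1) h1
        (by rw [hCdef]; push_cast; linarith) (by rw [hCdef]; push_cast; linarith)
    · exact gridDist_nonneg _ _
  have hA0 : 0 ≤ A := by rw [hAdef]; positivity
  have hC0 : 0 ≤ C := by rw [hCdef]; positivity
  have hCA : C ≤ A := by
    rw [hAdef, hCdef]; push_cast
    have : 0 ≤ (T : K) * u := by positivity
    linarith
  have hTA : (T : K) * u < A := by rw [hAdef]; push_cast; linarith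
  have hA2 : A ≤ (T : K) * (2 * u) := by
    rw [hAdef]; push_cast
    have : u ≤ (T : K) * u := le_mul_of_one_le_left hu.le hT1
    linarith
  have h00 : (((⟨0, hk⟩ : Fin k) : ℕ)) = 0 := rfl
  refine ⟨attBlock k A C, ⟨0, hk⟩, fun i => ?_, fun i => ?_, ?_, ?_, ?_⟩
  · by_cases hi : (i : ℕ) = 0
    · rw [attBlock_of_eq hi]; exact hA0
    · rw [attBlock_of_ne hi]; exact hC0
  · rw [attBlock_of_eq h00]
    by_cases hi : (i : ℕ) = 0
    · rw [attBlock_of_eq hi]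
    · rw [attBlock_of_ne hi]; exact hCA
  · rw [attBlock_of_eq h00]; exact hTA
  · rw [attBlock_of_eq h00]; exact hA2
  · have hC' : blockSSE hB (2 * u) (attBlock k A C) = (k : K) * u ^ 2 := by
      unfold blockSSE
      have hterm : ∀ i : Fin k, err hB (2 * u) (attBlock k A C i) ^ 2 = u ^ 2 := by
        intro i
        by_cases hi : (i : ℕ) = 0
        · rw [attBlock_of_eq hi, eC_top]
        · rw [attBlock_of_ne hi, eC_one]
      rw [Finset.sum_congr rfl (fun i _ => hterm i), Finset.sum_const, Finset.card_univ,
        Fintype.card_fin, nsmul_eq_mul]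
    have hF' : blockSSE hB u (attBlock k A C) = u ^ 2 := by
      unfold blockSSE
      rw [← Finset.add_sum_erase _ _ (Finset.mem_univ (⟨0, hk⟩ : Fin k))]
      have h0' : ∀ i ∈ Finset.univ.erase (⟨0, hk⟩ : Fin k), err hB u (attBlock k A C i) ^ 2 = 0 := by
        intro i hi
        have hne : (i : ℕ) ≠ 0 := by
          intro h
          exact Finset.ne_of_mem_erase hi (Fin.ext h)
        rw [attBlock_of_ne hne, eF_one]; ring
      rw [Finset.sum_congr rfl h0', Finset.sum_const_zero, add_zero, attBlock_of_eq h00, eF_top]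
    rw [hC', hF']; ring

/-- a point `w u` at integer distance `≥ R` from every FINE grid point has fine error `≥ R u` -/
theorem le_err_of_far_R {w R : ℕ} (hw : ∀ n ∈ B, w + R ≤ n ∨ n + R ≤ w) {u : K} (hu : 0 < u) :
    (R : K) * u ≤ err hB u ((w : K) * u) := by
  unfold err gridDist
  apply Finset.le_inf'
  intro v hv
  obtain ⟨n, hn, rfl⟩ := Finset.mem_image.mp hv
  have hR0 : (0 : K) ≤ R := Nat.cast_nonneg R
  rcases hw n hn with h | h
  · have : (w : K) + R ≤ n := by exact_mod_cast h
    rw [abs_of_nonpos (by nlinarith)]; nlinarith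
  · have : (n : K) + R ≤ w := by exact_mod_cast h
    rw [abs_of_nonneg (by nlinarith)]; nlinarith

/-- **Theorem S5, SSE, the `e = -1` comparison (generic).** For every block with maximum `a > T u` there is
a block with the same maximum whose SSE at the half scale `u` is at least the SSE of the given block at the
non-clipping scale `2u`: the other elements are all moved to the worst fine point `z` (`z = a` if clipping
`a` costs at least the fine covering radius `R u`, else the far point `w u` with fine error `≥ R u`). -/
theorem ceil_vs_half_sse {T Tm L Lm w R : ℕ} (hT : T ∈ B) (hle : ∀ n ∈ B, n ≤ T) (hTm : Tm ∈ B)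
    (hT2 : 2 * Tm = T) (hL : L ∈ B) (hLm : Lm ∈ B) (hL2 : 2 * Lm = L)
    (hAB : ∀ n ∈ B, L ≤ 2 * n → 2 * n ≤ T → 2 * n ∈ B)
    (hBA : ∀ n ∈ B, L ≤ n → n ≤ T → ∃ m ∈ B, 2 * m = n)
    (hlow : ∀ u y : K, 0 < u → 0 ≤ y → y ≤ (L : K) * u → err hB (2 * u) y ≤ u)
    (hcovF : ∀ u y : K, 0 < u → 0 ≤ y → y ≤ (T : K) * u → err hB u y ≤ (R : K) * u)
    (hR1 : 1 ≤ R) (hwT : w ≤ T) (hwR : ∀ n ∈ B, w + R ≤ n ∨ n + R ≤ w)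
    {k : ℕ} (x : Fin k → K) {u a : K} (hu : 0 < u) (hx0 : ∀ i, 0 ≤ x i) (hxa : ∀ i, x i ≤ a)
    (ha' : (T : K) * u < a) (i₀ : Fin k) (hi₀ : x i₀ = a) :
    ∃ x' : Fin k → K, (∀ i, 0 ≤ x' i) ∧ (∀ i, x' i ≤ a) ∧ x' i₀ = a ∧
      blockSSE hB (2 * u) x ≤ blockSSE hB u x' := by
  classical
  have hR1' : (1 : K) ≤ R := by exact_mod_cast hR1
  have hwu : (w : K) * u ≤ (T : K) * u := by
    have : (w : K) ≤ T := by exact_mod_cast hwT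
    nlinarith
  -- the worst fine point
  let z : K := if (R : K) * u ≤ a - (T : K) * u then a else (w : K) * u
  have hz0 : 0 ≤ z := by
    show 0 ≤ (if (R : K) * u ≤ a - (T : K) * u then a else (w : K) * u)
    split_ifs
    · linarith [hx0 i₀, hxa i₀]
    · positivity
  have hza : z ≤ a := by
    show (if (R : K) * u ≤ a - (T : K) * u then a else (w : K) * u) ≤ a
    split_ifs
    · exact le_rfl
    · linarith
  -- every element's coarse error is at most the fine error of z
  have hclipa : a - (T : K) * u ≤ err hB u a := sub_top_le_err hB hle hu.le a
  have hbound : ∀ y, 0 ≤ y → y ≤ a → err hB (2 * u) y ≤ err hB u z := by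
    intro y hy0 hya
    -- coarse error ≤ max (a - T u, R u)
    have hmax : err hB (2 * u) y ≤ a - (T : K) * u ∨ err hB (2 * u) y ≤ (R : K) * u := by
      by_cases h1 : (T : K) * u ≤ y
      · left; have := err_coarse_le_sub hB hTm hT2 (u := u) h1; linarith
      · right
        have hyT : y ≤ (T : K) * u := le_of_lt (lt_of_not_ge h1)
        by_cases h2 : (L : K) * u ≤ y
        · rw [err_coarse_eq_of_zone hB hT hTm hT2 hL hLm hL2 hAB hBA hu h2 hyT]
          exact hcovF u y hu hy0 hyT
        · have := hlow u y hu hy0 (le_of_lt (lt_of_not_ge h2))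
          nlinarith
    show err hB (2 * u) y ≤ err hB u (if (R : K) * u ≤ a - (T : K) * u then a else (w : K) * u)
    split_ifs with hz
    · rcases hmax with h | h <;> linarith
    · have hfar := le_err_of_far_R hB hwR hu
      have hz' := lt_of_not_ge hz
      rcases hmax with h | h <;> linarith
  let x' : Fin k → K := fun i => if x i = a then a else z
  refine ⟨x', fun i => ?_, fun i => ?_, ?_, ?_⟩
  · show 0 ≤ (if x i = a then a else z)
    split_ifs
    · linarith [hx0 i₀, hxa i₀]
    · exact hz0
  · show (if x i = a then a else z) ≤ a
    split_ifs
    · exact le_rfl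
    · exact hza
  · show (if x i₀ = a then a else z) = a
    rw [if_pos hi₀]
  · unfold blockSSE
    refine Finset.sum_le_sum (fun i _ => ?_)
    have h0 : 0 ≤ err hB (2 * u) (x i) := gridDist_nonneg _ _
    have hle' : err hB (2 * u) (x i) ≤ err hB u (x' i) := by
      show err hB (2 * u) (x i) ≤ err hB u (if x i = a then a else z)
      split_ifs with hxi
      · rw [hxi]
        have h1 : (T : K) * u ≤ a := ha'.le
        have := err_coarse_le_sub hB hTm hT2 (u := u) h1
        linarith
      · exact hbound (x i) (hx0 i) (hxa i)
    nlinarith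

/-- **Theorem S5, SSE, finer scales (generic, in the convention of `two_candidates`: non-clipping scale
parameter `s`, `T s < 2 a ≤ 2 T s`).** At every scale `s / 2^n`, `n ≥ 2`, the constant block `(a, …, a)`
does at least as badly in SSE as any block does at scale `s`. -/
theorem finer_sse_const {T : ℕ} (hle : ∀ n ∈ B, n ≤ T) {R : K} (hR : 4 * R ≤ T)
    (hcov : ∀ s y : K, 0 < s → 0 ≤ y → y ≤ (T : K) * s → err hB s y ≤ R * s)
    {k : ℕ} (x : Fin k → K) {s a : K} (hs : 0 < s) (hx0 : ∀ i, 0 ≤ x i) (hxa : ∀ i, x i ≤ a)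
    (ha : a ≤ (T : K) * s) (ha' : (T : K) * s < 2 * a) {n : ℕ} (hn : 2 ≤ n) :
    blockSSE hB s x ≤ blockSSE hB (s / 2 ^ n) (fun _ : Fin k => a) := by
  unfold blockSSE
  refine Finset.sum_le_sum (fun i _ => ?_)
  have h0 : 0 ≤ err hB s (x i) := gridDist_nonneg _ _
  have hlt := finer_clips_lt hB hle hR (hcov s (x i) hs (hx0 i) ((hxa i).trans ha)) hs ha' hn
  nlinarith

end SSEGain

end Summit.Ventures.CertifiedArithmetic.LowPrec.Opt
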